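import Mathlib.CategoryTheory.Comma.Over.Basic
import Literature.AlgebraicGeometry.Frobenioids.GroupLikeStandardExample
import Literature.AlgebraicGeometry.Frobenioids.RationalSemidirectBase
import HarnessLib

/-!
# Frobenioids I, §3: Example 3.9 (non-preservation of units) and Remark 4.11.2 (first half)

Mochizuki, *The geometry of Frobenioids I: the general theory*, Kyushu J. Math. **62** (2008)
293–400, kurims text pp. 71–72, 94 [cite: MochizukiFrdI2008, Ex. 3.9 pp.71-72].  Data: `N`, `U = ℚ`,
`G = U ⋊ N`, `D` (file `RationalSemidirectBase.lean`), `V := ℚ`, `W := ℤ_{≥0}`, the monoid `Φ` on `D`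
with `g ↦ (n, 1)` (DEFINED as a genuine functor `Dᵒᵖ ⥤ CommMonCat`), `C := F_Φ` (found's
`ElemFrobenioid`).

PROVED: "`D` is manifestly of FSM-, hence also of FSMFF-type"; the printed monoid `M` on
`U × V × W × N × N_{≥1}` is a monoid; "the assignment `(u, v, w, n, m) ↦ (v, u, w, n⁻¹ m⁻¹, m)`
determines an automorphism of the monoid `M`" (homomorphism + involution); it "fails to preserve
`O^×(−)`, `O^▷(−)` [i.e., the subspaces `{0} × V × {0}`, `{0} × V × W`]" (witness); and, for Remark
4.11.2, "the subgroup `U` of `G` acts trivially on `V × W`" (`act_inU`).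
COMPUTED (Def. 1.1 (iii)) and RECORDED: under the evident bijection `End_C ≃ M` the `U, W, N, N_{≥1}`
coordinates multiply as printed, while the `V`-coordinate of a product is `n_ψ · v_φ + m_φ · v_ψ`
— the printed `v₁ + m₁ n₁ v₂` attaches the twist to the other factor (the two agree in the
coordinates `v ↦ n⁻¹ v` exactly when `Φ(g)` is read as the inverse of the displayed automorphism);
the printed identification `EndLawAsPrinted` is therefore typed FALSE-AS-TYPED and
REFUTED in-file (`not_endLawAsPrinted`, RULING P1).
Typed as named statements: "`Aut(D_A → D) ≅ G`".  Deliberately NOT here (predicates of seats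
found/t3 not yet landed): "`C` is a Frobenioid of Frobenius-normalized and isotropic type, not of
group-like type", "`C` is of standard type", "`D` fails to be Frobenius-slim / Div-slim" (the
monoid injection `𝔽 ↪ G` and the triviality of `U` on `V × W` that these rest on ARE proved, in
`RationalSemidirectBase.lean` and here).  No statement of the paper is strengthened.
-/

namespace Literature.AlgebraicGeometry.Frobenioids

open CategoryTheory

/-! ### Example 3.9: non-preservation of units -/

namespace Ex39

open RatSemidirect

/-- The action of Ex. 3.9: `g = (u, n) ∈ G` acts on `V × W = ℚ × ℤ_{≥0}` by `(n, 1)`, "i.e., the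
automorphism that acts on `V` by `n` and on `W` by `1`" (FrdI p. 72; written multiplicatively).
[cite: MochizukiFrdI2008, Ex. 3.9 p.72] -/
def act (g : G) : Multiplicative (ℚ × ℕ) →* Multiplicative (ℚ × ℕ) :=
  AddMonoidHom.toMultiplicative
    { toFun := fun z => ((g.n : ℚ) * z.1, z.2)
      map_zero' := by simp
      map_add' := fun z z' => by ext <;> simp [mul_add] }

/-- Values of the action. [cite: MochizukiFrdI2008, Ex. 3.9 p.72] -/
@[simp] theorem toAdd_act (g : G) (z : Multiplicative (ℚ × ℕ)) :
    Multiplicative.toAdd (act g z) = ((g.n : ℚ) * (Multiplicative.toAdd z).1, (Multiplicative.toAdd z).2) :=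
  rfl

/-- The action is compatible with the product of `G` (it factors through `G ↠ N`, abelian).
[cite: MochizukiFrdI2008, Ex. 3.9 p.72] -/
theorem act_mul (g g' : G) : act (g * g') = (act g').comp (act g) := by
  refine MonoidHom.ext fun z => Multiplicative.toAdd.injective ?_
  simp only [toAdd_act, MonoidHom.coe_comp, Function.comp_apply, G.mul_n, Positive.val_mul,
    Prod.mk.injEq]
  exact ⟨by ring, trivial⟩

/-- `act 1 = id`. [cite: MochizukiFrdI2008, Ex. 3.9 p.72] -/
theorem act_one : act 1 = MonoidHom.id _ := by
  refine MonoidHom.ext fun z => Multiplicative.toAdd.injective ?_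
  simp [toAdd_act, Positive.val_one]

/-- "since the subgroup `U` of `G` … acts trivially on `V × W`" (FrdI Rem. 4.11.2 p. 94, about Ex. 3.9;
PROVED). [cite: MochizukiFrdI2008, Rem. 4.11.2 p.94] -/
theorem act_inU (u : ℚ) : act (inU u) = MonoidHom.id _ := by
  refine MonoidHom.ext fun z => Multiplicative.toAdd.injective ?_
  simp [toAdd_act, inU, Positive.val_one]

/-- `Φ`: "the monoid on `D` that associates to the unique object of `D` the monoid `V × W` and to a
morphism `g ∈ G` that projects to `n ∈ N` the automorphism of `V × W` given by `(n, 1)`" (FrdI p. 72),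
as a functor `Dᵒᵖ ⥤ CommMonCat`. [cite: MochizukiFrdI2008, Ex. 3.9 p.72] -/
def Φ : Dᵒᵖ ⥤ CommMonCat.{0} where
  obj _ := CommMonCat.of (Multiplicative (ℚ × ℕ))
  map f := CommMonCat.ofHom (act (show G from f.unop))
  map_id A := by
    ext x : 2
    change act 1 x = x
    rw [act_one]; rfl
  map_comp f g := by
    ext x : 2
    change act ((show G from f.unop) * (show G from g.unop)) x = act _ (act _ x)
    rw [act_mul]; rfl

/-- `C := F_Φ` (FrdI p. 72), found's elementary Frobenioid; its unique object.
[cite: MochizukiFrdI2008, Ex. 3.9 p.72] -/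
abbrev obj : ElemFrobenioid Φ := ElemFrobenioid.of Φ (SingleObj.star G)

/-- "`D` is manifestly of FSM-type" (FrdI p. 72; PROVED: `G` is a group, so every arrow of `D` is an
isomorphism). [cite: MochizukiFrdI2008, Ex. 3.9 p.72] -/
theorem isOfFSMType_D : IsOfFSMType D :=
  ⟨fun f _ => (SingleObj.isIso_iff_isUnit f).mpr (Group.isUnit _)⟩

/-- "… hence also of FSMFF-type [cf. §0]" (FrdI p. 72; PROVED). [cite: MochizukiFrdI2008, Ex. 3.9 p.72] -/
theorem isOfFSMFFType_D : IsOfFSMFFType D := isOfFSMType_D.isOfFSMFFType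

/-- The printed monoid `M`: underlying set `U × V × W × N × N_{≥1}` (FrdI p. 72).
[cite: MochizukiFrdI2008, Ex. 3.9 p.72] -/
@[ext] structure M : Type where
  /-- `u ∈ U = ℚ` -/
  u : ℚ
  /-- `v ∈ V = ℚ` -/
  v : ℚ
  /-- `w ∈ W = ℤ_{≥0}` -/
  w : ℕ
  /-- `n ∈ N = (N_{≥1})^gp` -/
  n : N
  /-- `m ∈ N_{≥1}` -/
  m : ℕ+

namespace M

/-- The printed law `(u₁,v₁,w₁,n₁,m₁) · (u₂,v₂,w₂,n₂,m₂) = (u₁ + n₁⁻¹ u₂, v₁ + m₁ n₁ v₂, w₁ + m₁ w₂,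
n₁ n₂, m₁ m₂)` (FrdI p. 72) is a monoid structure (PROVED). [cite: MochizukiFrdI2008, Ex. 3.9 p.72] -/
instance instMonoid : Monoid M where
  mul x y := ⟨x.u + (x.n : ℚ)⁻¹ * y.u, x.v + (x.m : ℚ) * (x.n : ℚ) * y.v, x.w + (x.m : ℕ) * y.w,
    x.n * y.n, x.m * y.m⟩
  one := ⟨0, 0, 0, 1, 1⟩
  mul_assoc x y z := by
    refine M.ext ?_ ?_ ?_ (mul_assoc _ _ _) (mul_assoc _ _ _)
    · show x.u + (x.n : ℚ)⁻¹ * y.u + ((x.n * y.n : N) : ℚ)⁻¹ * z.u =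
        x.u + (x.n : ℚ)⁻¹ * (y.u + (y.n : ℚ)⁻¹ * z.u)
      rw [Positive.val_mul, mul_inv]; ring
    · show x.v + (x.m : ℚ) * (x.n : ℚ) * y.v + ((x.m * y.m : ℕ+) : ℚ) * ((x.n * y.n : N) : ℚ) * z.v =
        x.v + (x.m : ℚ) * (x.n : ℚ) * (y.v + (y.m : ℚ) * (y.n : ℚ) * z.v)
      rw [Positive.val_mul, PNat.mul_coe, Nat.cast_mul]; ring
    · show x.w + (x.m : ℕ) * y.w + ((x.m * y.m : ℕ+) : ℕ) * z.w = x.w + (x.m : ℕ) * (y.w + (y.m : ℕ) * z.w)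
      rw [PNat.mul_coe]; ring
  one_mul x := by
    refine M.ext ?_ ?_ ?_ (one_mul _) (one_mul _)
    · show 0 + ((1 : N) : ℚ)⁻¹ * x.u = x.u
      simp [Positive.val_one]
    · show 0 + ((1 : ℕ+) : ℚ) * ((1 : N) : ℚ) * x.v = x.v
      simp [Positive.val_one]
    · show 0 + ((1 : ℕ+) : ℕ) * x.w = x.w
      simp
  mul_one x := by
    refine M.ext ?_ ?_ ?_ (mul_one _) (mul_one _)
    · show x.u + (x.n : ℚ)⁻¹ * 0 = x.u
      simp
    · show x.v + (x.m : ℚ) * (x.n : ℚ) * 0 = x.v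
      simp
    · show x.w + (x.m : ℕ) * 0 = x.w
      simp

/-- Components of the product. [cite: MochizukiFrdI2008, Ex. 3.9 p.72] -/
@[simp] theorem mul_u (x y : M) : (x * y).u = x.u + (x.n : ℚ)⁻¹ * y.u := rfl
/-- Components of the product. [cite: MochizukiFrdI2008, Ex. 3.9 p.72] -/
@[simp] theorem mul_v (x y : M) : (x * y).v = x.v + (x.m : ℚ) * (x.n : ℚ) * y.v := rfl
/-- Components of the product. [cite: MochizukiFrdI2008, Ex. 3.9 p.72] -/
@[simp] theorem mul_w (x y : M) : (x * y).w = x.w + (x.m : ℕ) * y.w := rfl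
/-- Components of the product. [cite: MochizukiFrdI2008, Ex. 3.9 p.72] -/
@[simp] theorem mul_n (x y : M) : (x * y).n = x.n * y.n := rfl
/-- Components of the product. [cite: MochizukiFrdI2008, Ex. 3.9 p.72] -/
@[simp] theorem mul_m (x y : M) : (x * y).m = x.m * y.m := rfl
/-- The unit. [cite: MochizukiFrdI2008, Ex. 3.9 p.72] -/
@[simp] theorem one_u : (1 : M).u = 0 := rfl
/-- The unit. [cite: MochizukiFrdI2008, Ex. 3.9 p.72] -/
@[simp] theorem one_v : (1 : M).v = 0 := rfl
/-- The unit. [cite: MochizukiFrdI2008, Ex. 3.9 p.72] -/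
@[simp] theorem one_w : (1 : M).w = 0 := rfl
/-- The unit. [cite: MochizukiFrdI2008, Ex. 3.9 p.72] -/
@[simp] theorem one_n : (1 : M).n = 1 := rfl
/-- The unit. [cite: MochizukiFrdI2008, Ex. 3.9 p.72] -/
@[simp] theorem one_m : (1 : M).m = 1 := rfl

end M

/-- The evident bijection of SETS `End_C ≃ M`: `(Base = (u, n), Div = (v, w), deg_Fr = m) ↦
(u, v, w, n, m)` (FrdI p. 72 "The monoid `M` of endomorphisms … may be described as the product set
…"). [cite: MochizukiFrdI2008, Ex. 3.9 p.72] -/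
def endEquivSet : End obj ≃ M where
  toFun φ := ⟨(ElemFrobenioid.Base φ).u, (Multiplicative.toAdd (ElemFrobenioid.Div φ)).1,
    (Multiplicative.toAdd (ElemFrobenioid.Div φ)).2, (ElemFrobenioid.Base φ).n, ElemFrobenioid.degFr φ⟩
  invFun x := ElemFrobenioid.homMk (⟨x.u, x.n⟩ : G) (Multiplicative.ofAdd (x.v, x.w)) x.m
  left_inv _ := rfl
  right_inv _ := rfl

/-- The `U`, `W`, `N`, `N_{≥1}`-coordinates of `endEquivSet` are multiplicative for the printed law
(PROVED from Def. 1.1 (iii)). [cite: MochizukiFrdI2008, Ex. 3.9 p.72] -/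
theorem endEquivSet_mul_uwnm (φ ψ : End obj) :
    (endEquivSet (φ * ψ)).u = (endEquivSet φ * endEquivSet ψ).u ∧
    (endEquivSet (φ * ψ)).w = (endEquivSet φ * endEquivSet ψ).w ∧
    (endEquivSet (φ * ψ)).n = (endEquivSet φ * endEquivSet ψ).n ∧
    (endEquivSet (φ * ψ)).m = (endEquivSet φ * endEquivSet ψ).m := by
  refine ⟨rfl, ?_, rfl, mul_comm _ _⟩
  show (Multiplicative.toAdd (act (ElemFrobenioid.Base ψ) (ElemFrobenioid.Div φ) *
      (show Multiplicative (ℚ × ℕ) from ElemFrobenioid.Div ψ) ^ (ElemFrobenioid.degFr φ : ℕ))).2 = _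
  simp only [toAdd_mul, toAdd_pow, toAdd_act, Prod.snd_add, Prod.smul_snd, smul_eq_mul, M.mul_w]
  rfl

/-- The `V`-coordinate of a product in `End_C` COMPUTED from Def. 1.1 (iii) (`Div(φ ∘ ψ) =
ψ_D^*(Div φ) + deg_Fr(φ) · Div(ψ)`, `ψ_D^*` = multiplication by `n_ψ` on `V`):
`v(φ·ψ) = n_ψ · v(φ) + m_φ · v(ψ)` (PROVED).  CAVEAT (recorded for the referee): the printed law has
`v₁ + m₁ n₁ v₂`, i.e. the twist by the LEFT factor's `n`; the two agree after the change of
coordinates `v ↦ n⁻¹ v` exactly when `Φ(g)` is read as the INVERSE of the displayed automorphism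
(covariant convention); under the literal reading they differ (e.g. `n_ψ = 2`, `v_φ = 1`, `v_ψ = 0`,
`m = 1`: `2` here, `1` there).  No repair attempted. [cite: MochizukiFrdI2008, Ex. 3.9 p.72] -/
theorem endEquivSet_mul_v (φ ψ : End obj) :
    (endEquivSet (φ * ψ)).v =
      ((endEquivSet ψ).n : ℚ) * (endEquivSet φ).v + ((endEquivSet φ).m : ℚ) * (endEquivSet ψ).v := by
  show (Multiplicative.toAdd (act (ElemFrobenioid.Base ψ) (ElemFrobenioid.Div φ) *
      (show Multiplicative (ℚ × ℕ) from ElemFrobenioid.Div ψ) ^ (ElemFrobenioid.degFr φ : ℕ))).1 = _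
  simp only [toAdd_mul, toAdd_pow, toAdd_act, Prod.fst_add, nsmul_eq_mul]
  rfl

/-- FALSE AS TYPED (erratum candidate E1 / printed-claim-under-review; RULING P1): FrdI Ex. 3.9, the
evident bijection `End_C ≃ M` is multiplicative for the PRINTED law of `M`.  The `U, W, N, N_{≥1}` parts
hold (`endEquivSet_mul_uwnm`); the `V`-part does not under the literal reading of `Φ(g)`: the computed
law is `endEquivSet_mul_v` (REPAIRED statement, PROVED) and `not_endLawAsPrinted` refutes the printed
one (witness `n_ψ = 2`, `v_φ = 1`, `v_ψ = 0`: `2 ≠ 1`).  Convention note: no rescaling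
`v ↦ λ(Base, deg_Fr)·v` rescues the print under the literal action, whereas reading `Φ(g)` as the
INVERSE of the displayed automorphism together with `v ↦ n_{Base}·v` does — so this discrepancy is
convention-level (unlike Ex. 3.7).  Consumers must NOT bind `(h : EndLawAsPrinted)`.
[cite: MochizukiFrdI2008, Ex. 3.9 p.72] -/
def EndLawAsPrinted : Prop := ∀ φ ψ : End obj, endEquivSet (φ * ψ) = endEquivSet φ * endEquivSet ψ

/-- Kernel-checked refutation of `EndLawAsPrinted` (RULING P1; erratum candidate E1, convention-level,
recorded neutrally). [cite: MochizukiFrdI2008, Ex. 3.9 p.72] -/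
theorem not_endLawAsPrinted : ¬ EndLawAsPrinted := by
  intro h
  let two : N := ⟨2, by norm_num⟩
  let φ : End obj := endEquivSet.symm ⟨0, 1, 0, 1, 1⟩
  let ψ : End obj := endEquivSet.symm ⟨0, 0, 0, two, 1⟩
  have h1 := congrArg M.v (h φ ψ)
  rw [endEquivSet_mul_v] at h1
  simp only [φ, ψ, two, Equiv.apply_symm_apply, M.mul_v, PNat.one_coe, Nat.cast_one, Positive.val_one,
    mul_zero, mul_one, add_zero] at h1
  norm_num at h1

/-- "a routine verification reveals that the assignment `(u, v, w, n, m) ↦ (v, u, w, n⁻¹ · m⁻¹, m)`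
determines an automorphism of the monoid `M`" (FrdI p. 72; PROVED for the printed law: a monoid
homomorphism which is an involution). [cite: MochizukiFrdI2008, Ex. 3.9 p.72] -/
def θ : M →* M where
  toFun x := ⟨x.v, x.u, x.w, x.n⁻¹ * (natPos x.m)⁻¹, x.m⟩
  map_one' := M.ext rfl rfl rfl (by simp) rfl
  map_mul' x y := by
    refine M.ext ?_ ?_ rfl ?_ rfl
    · show (x * y).v = x.v + ((x.n⁻¹ * (natPos x.m)⁻¹ : N) : ℚ)⁻¹ * y.v
      rw [M.mul_v, Positive.val_mul, Positive.coe_inv, Positive.coe_inv, natPos_val]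
      rw [mul_inv, inv_inv, inv_inv, mul_comm ((x.n : ℚ))]
    · show (x * y).u = x.u + (x.m : ℚ) * ((x.n⁻¹ * (natPos x.m)⁻¹ : N) : ℚ) * y.u
      rw [M.mul_u, Positive.val_mul, Positive.coe_inv, Positive.coe_inv, natPos_val]
      have hm : ((x.m : ℕ) : ℚ) ≠ 0 := by exact_mod_cast x.m.ne_zero
      field_simp
    · show (x * y).n⁻¹ * (natPos (x * y).m)⁻¹ = x.n⁻¹ * (natPos x.m)⁻¹ * (y.n⁻¹ * (natPos y.m)⁻¹)
      rw [M.mul_n, M.mul_m, map_mul, mul_inv, mul_inv, mul_mul_mul_comm]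

/-- `θ` is an involution (hence bijective: an automorphism of `M`). [cite: MochizukiFrdI2008, Ex. 3.9 p.72] -/
theorem θ_θ (x : M) : θ (θ x) = x := by
  refine M.ext rfl rfl rfl ?_ rfl
  show (x.n⁻¹ * (natPos x.m)⁻¹)⁻¹ * (natPos x.m)⁻¹ = x.n
  rw [mul_inv, inv_inv, inv_inv, mul_assoc, mul_inv_cancel, mul_one]

/-- The automorphism `θ` as a `MulEquiv`. [cite: MochizukiFrdI2008, Ex. 3.9 p.72] -/
def θEquiv : M ≃* M :=
  { θ with invFun := θ, left_inv := θ_θ, right_inv := θ_θ }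

/-- "… hence a self-equivalence of `C`, which clearly fails to preserve `O^×(−)`, `O^▷(−)` [i.e., the
subspaces `{0} × V × {0}`, `{0} × V × W ⊆ U × V × W]" (FrdI p. 72; PROVED at the level of `M`:
`(0, 1, 0, 1, 1)` lies in `{0} × V × {0}` and its image `(1, 0, 0, 1, 1)` has `u ≠ 0`).
[cite: MochizukiFrdI2008, Ex. 3.9 p.72] -/
theorem θ_not_preserves_units :
    ∃ x : M, x.u = 0 ∧ x.w = 0 ∧ (θ x).u ≠ 0 :=
  ⟨⟨0, 1, 0, 1, 1⟩, rfl, rfl, one_ne_zero⟩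

/-- "`Aut(D_A → D) ≅ G`" (FrdI Ex. 3.8 p. 71, used again in Rem. 4.11.2 p. 94 for Ex. 3.9) — named
statement. [cite: MochizukiFrdI2008, Ex. 3.8 p.71] -/
def AutForgetIsoG : Prop := Nonempty (Aut (Over.forget (SingleObj.star G)) ≃* G)

end Ex39

end Literature.AlgebraicGeometry.Frobenioids
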